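import Summits.Ventures.Crystal3D.Theorems.StickyWulffConstantStackingLiminfPlateauProfile
import Summits.Ventures.Crystal3D.Theorems.StickyWulffConstantStackingLiminfBarlowCellsCovering
import HarnessLib

/-!
# Plateau height for line `LayerChain` v4 (crux `StackingLiminf`, stmt-Ventures-19145), part 4:
# the LOWER full-lattice bound — the bumps of all lattice points near `y` sum to `≥ √2 ∫φ_K − C/K`

Route `StickyWulffConstant` of the venture `Summits/Ventures/Crystal3D` (cell `crystal3d-full`).
**`sqrt_two_mul_integral_bump_sub_le_sum`**: for every letter sequence `s`, every `K ≥ 1`, every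
`y ∈ ℝ³` and every finite set `F` of lattice indices containing all `(k,i,j)` with
`|y − barlowPos 1 √(2/3) s k i j| < K`,
`√2 · ∫ φ_K − 96 √2 · bumpConst / K ≤ Σ_{(k,i,j) ∈ F} φ_K(y − barlowPos k i j)`.
With `∫ φ_K = 1/√2` (rung R1) this says that the `K`-mollified density of the FULL stacking is
`≥ 1 − C/K` everywhere; subtracting the occupied part `dens x K y ≤ 1 − θ` gives the vacancy density
`u(y) ≥ θ − C/K` on the sub-plateau set `{w ≤ 1 − θ}` — the input of the bad-mass step of stub (C)
`stub_plateauBound` (planner cf-p1 g13).  Mirror image of part 3: the cells of the lattice points TILE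
space (`exists_barlowCells_covering`), on the cell of `p` the bump `φ_K(y − p)` dominates the
MINORANT `c_K G((|q − y| + 2)/K)`, which vanishes off `B(y, K − 2)` — a region covered by the cells
of the points of `F` — and falls short of `φ_K` by at most `12 c_K/K` on `B̄_∞(0, K)`.
WHAT THIS IS NOT: not stub (C); rung F-C1 not moved.
-/

noncomputable section

namespace Summit.Ventures.Crystal3D.Theorems.PlateauHeight

open MeasureTheory Set Metric
open Literature.MathematicalPhysics.StatisticalMechanics (barlowPos barlowStacking haggLabel)
open Summit.Ventures.Crystal3D.Cruxes.StackingLiminf.LayerChainV4 (bump bumpConst)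
open Summit.Ventures.Crystal3D.LayerChain (dot3)

/-- Triangle inequality for the Euclidean length on `Fin 3 → ℝ`. -/
theorem sqrt_dot3_add_le (a b : Fin 3 → ℝ) :
    Real.sqrt (dot3 (a + b) (a + b)) ≤ Real.sqrt (dot3 a a) + Real.sqrt (dot3 b b) := by
  rw [sqrt_dot3_self, sqrt_dot3_self, sqrt_dot3_self, WithLp.toLp_add]
  exact norm_add_le _ _

/-- **Pointwise minorant.**  If `q` is within Euclidean distance `2` of the centre `p` then
`c_K · G((|q − y| + 2)/K) ≤ φ_K(y − p)`. -/
theorem minorant_le_bump {K : ℝ} (hK : 0 < K) (y p q : Fin 3 → ℝ)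
    (hq : Real.sqrt (dot3 (q - p) (q - p)) ≤ 2) :
    bumpConst / K ^ 3 *
        (max 0 (1 - (max 0 ((Real.sqrt (dot3 (q - y) (q - y)) + 2) / K)) ^ 2)) ^ 3 ≤
      bump K (fun j => y j - p j) := by
  rw [bump_eq_profile hK]
  refine mul_le_mul_of_nonneg_left (profile_antitone ?_)
    (div_nonneg bumpConst_pos.le (pow_nonneg hK.le 3))
  -- `|y − p|/K ≤ (|q − y| + 2)/K`
  apply div_le_div_of_nonneg_right _ hK.le
  have h1 := sqrt_dot3_add_le (y - q) (q - p)
  have e1 : (y - q) + (q - p) = (fun j => y j - p j) := by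
    ext j; simp only [Pi.add_apply, Pi.sub_apply]; ring
  have e2 : dot3 (y - q) (y - q) = dot3 (q - y) (q - y) := by
    simp only [dot3, Pi.sub_apply]; ring
  rw [e1, e2] at h1
  linarith

/-- **Comparison of the bump with the minorant at the same point** (Lipschitz bound):
`φ_K(q) − c_K G((|q| + 2)/K) ≤ (12 c_K / K) · 1_{B̄_∞(0, K)}(q)`. -/
theorem bump_sub_minorant_le {K : ℝ} (hK : 0 < K) (q : Fin 3 → ℝ) :
    bump K q - bumpConst / K ^ 3 * (max 0 (1 - (max 0 ((Real.sqrt (dot3 q q) + 2) / K)) ^ 2)) ^ 3 ≤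
      (closedBall (0 : Fin 3 → ℝ) K).indicator (fun _ => 12 * bumpConst / K ^ 4) q := by
  have hc : 0 ≤ bumpConst / K ^ 3 := div_nonneg bumpConst_pos.le (pow_nonneg hK.le 3)
  rw [bump_eq_profile hK]
  by_cases hq : q ∈ closedBall (0 : Fin 3 → ℝ) K
  · rw [indicator_of_mem hq, ← mul_sub]
    have h := profile_sub_le (show Real.sqrt (dot3 q q) / K ≤ (Real.sqrt (dot3 q q) + 2) / K from
      div_le_div_of_nonneg_right (by linarith) hK.le)
    have e : (Real.sqrt (dot3 q q) + 2) / K - Real.sqrt (dot3 q q) / K = 2 / K := by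
      field_simp; ring
    rw [e] at h
    calc bumpConst / K ^ 3 * ((max 0 (1 - max 0 (Real.sqrt (dot3 q q) / K) ^ 2)) ^ 3 -
          (max 0 (1 - max 0 ((Real.sqrt (dot3 q q) + 2) / K) ^ 2)) ^ 3)
        ≤ bumpConst / K ^ 3 * (6 * (2 / K)) := mul_le_mul_of_nonneg_left h hc
      _ = 12 * bumpConst / K ^ 4 := by field_simp; ring
  · rw [indicator_of_notMem hq]
    have hq' : K < ‖q‖ := by rwa [mem_closedBall, dist_zero_right, not_le] at hq
    have hr : K < Real.sqrt (dot3 q q) := lt_of_lt_of_le hq' (norm_le_sqrt_dot3 q)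
    have h1 : 1 < Real.sqrt (dot3 q q) / K := by rw [lt_div_iff₀ hK]; linarith
    have h2 : 1 < (Real.sqrt (dot3 q q) + 2) / K := by rw [lt_div_iff₀ hK]; linarith
    rw [profile_eq_zero h1, profile_eq_zero h2]
    simp

/-- The translated minorant is continuous. -/
theorem continuous_minorant (K : ℝ) (y : Fin 3 → ℝ) :
    Continuous fun q : Fin 3 → ℝ =>
      bumpConst / K ^ 3 * (max 0 (1 - (max 0 ((Real.sqrt (dot3 (q - y) (q - y)) + 2) / K)) ^ 2)) ^ 3 := by
  unfold dot3
  fun_prop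

/-- The translated minorant vanishes outside the Euclidean ball `B(y, K − 2)`, in particular
outside the sup-norm ball `B̄(y, K)`. -/
theorem minorant_eq_zero_of_le {K : ℝ} (hK : 0 < K) (y : Fin 3 → ℝ) {q : Fin 3 → ℝ}
    (hq : K - 2 ≤ Real.sqrt (dot3 (q - y) (q - y))) :
    bumpConst / K ^ 3 *
      (max 0 (1 - (max 0 ((Real.sqrt (dot3 (q - y) (q - y)) + 2) / K)) ^ 2)) ^ 3 = 0 := by
  have h1 : 1 ≤ (Real.sqrt (dot3 (q - y) (q - y)) + 2) / K := by
    rw [le_div_iff₀ hK]; linarith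
  have : max 0 (1 - (max 0 ((Real.sqrt (dot3 (q - y) (q - y)) + 2) / K)) ^ 2) = 0 := by
    refine max_eq_left ?_
    have hm : 1 ≤ max 0 ((Real.sqrt (dot3 (q - y) (q - y)) + 2) / K) := le_max_of_le_right h1
    nlinarith
  rw [this]
  ring

/-- The translated minorant is integrable (`K > 0`). -/
theorem integrable_minorant {K : ℝ} (hK : 0 < K) (y : Fin 3 → ℝ) :
    Integrable fun q : Fin 3 → ℝ =>
      bumpConst / K ^ 3 * (max 0 (1 - (max 0 ((Real.sqrt (dot3 (q - y) (q - y)) + 2) / K)) ^ 2)) ^ 3 := by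
  refine (continuous_minorant K y).integrable_of_hasCompactSupport ?_
  refine HasCompactSupport.intro (isCompact_closedBall y K) fun q hq => ?_
  rw [mem_closedBall, dist_eq_norm, not_le] at hq
  exact minorant_eq_zero_of_le hK y (by linarith [norm_le_sqrt_dot3 (q - y)])

/-- The (untranslated) minorant integrates to at least `∫ φ_K − 96 bumpConst / K`. -/
theorem integral_bump_sub_le_integral_minorant {K : ℝ} (hK : 0 < K) :
    (∫ u, bump K u) - 96 * bumpConst / K ≤
      ∫ q : Fin 3 → ℝ, bumpConst / K ^ 3 *
        (max 0 (1 - (max 0 ((Real.sqrt (dot3 q q) + 2) / K)) ^ 2)) ^ 3 := by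
  have hint0 : Integrable fun q : Fin 3 → ℝ => bumpConst / K ^ 3 *
      (max 0 (1 - (max 0 ((Real.sqrt (dot3 q q) + 2) / K)) ^ 2)) ^ 3 := by
    have := integrable_minorant hK 0
    simpa using this
  have hind : Integrable fun q : Fin 3 → ℝ =>
      (closedBall (0 : Fin 3 → ℝ) K).indicator (fun _ => 12 * bumpConst / K ^ 4) q :=
    (integrable_indicator_iff measurableSet_closedBall).2
      ((integrableOn_const_iff).2 (Or.inr measure_closedBall_lt_top))
  have h1 : (∫ u, bump K u) ≤ ∫ q : Fin 3 → ℝ, (bumpConst / K ^ 3 *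
        (max 0 (1 - (max 0 ((Real.sqrt (dot3 q q) + 2) / K)) ^ 2)) ^ 3 +
      (closedBall (0 : Fin 3 → ℝ) K).indicator (fun _ => 12 * bumpConst / K ^ 4) q) :=
    integral_mono (integrable_bump hK) (hint0.add hind) fun q => by
      have := bump_sub_minorant_le hK q
      simp only at this ⊢
      linarith
  rw [integral_add hint0 hind, integral_indicator_const _ measurableSet_closedBall, smul_eq_mul,
    measureReal_def, Real.volume_pi_closedBall _ hK.le, ENNReal.toReal_ofReal (by positivity)] at h1
  simp only [Fintype.card_fin] at h1
  have e : 12 * bumpConst / K ^ 4 * (2 * K) ^ 3 = 96 * bumpConst / K := by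
    field_simp; ring
  linarith

/-- **Lower full-lattice bound.**  For every letter sequence `s`, `K ≥ 1`, `y ∈ ℝ³` and every finite
index set `F` containing all lattice indices `(k, i, j)` with `|y − barlowPos 1 √(2/3) s k i j| < K`:
`√2 ∫ φ_K − 96 √2 · bumpConst / K ≤ Σ_{(k,i,j) ∈ F} φ_K(y − barlowPos 1 √(2/3) s k i j)`. -/
theorem sqrt_two_mul_integral_bump_sub_le_sum (s : ℤ → ℤ) {K : ℝ} (hK : 1 ≤ K) (y : Fin 3 → ℝ)
    (F : Finset (ℤ × ℤ × ℤ))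
    (hF : ∀ k i j : ℤ, Real.sqrt (dot3 (y - WithLp.ofLp (barlowPos 1 (Real.sqrt (2 / 3)) s k i j))
      (y - WithLp.ofLp (barlowPos 1 (Real.sqrt (2 / 3)) s k i j))) < K → (k, i, j) ∈ F) :
    Real.sqrt 2 * (∫ u, bump K u) - 96 * Real.sqrt 2 * bumpConst / K ≤
      ∑ t ∈ F, bump K (fun l => y l -
        WithLp.ofLp (barlowPos 1 (Real.sqrt (2 / 3)) s t.1 t.2.1 t.2.2) l) := by
  have hK0 : 0 < K := by linarith
  have hr2 : 0 < Real.sqrt 2 := Real.sqrt_pos.2 (by norm_num)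
  obtain ⟨Q, hQm, hQv, hQd, hQdisj, hQcov⟩ := exists_barlowCells_covering
  -- shorthand for the lattice points
  set P : ℤ × ℤ × ℤ → (Fin 3 → ℝ) := fun t =>
    WithLp.ofLp (barlowPos 1 (Real.sqrt (2 / 3)) s t.1 t.2.1 t.2.2) with hP
  -- the translated minorant
  set Ψ : (Fin 3 → ℝ) → ℝ := fun q =>
    bumpConst / K ^ 3 * (max 0 (1 - (max 0 ((Real.sqrt (dot3 (q - y) (q - y)) + 2) / K)) ^ 2)) ^ 3
    with hΨ
  have hΨint : Integrable Ψ := integrable_minorant hK0 y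
  have hvolR : ∀ p, (volume (Q p)).toReal = 1 / Real.sqrt 2 := fun p => by
    rw [hQv, ENNReal.toReal_ofReal (by positivity)]
  -- per point: `√2 ∫_{Q(P t)} Ψ ≤ φ_K(y − P t)`
  have hpt : ∀ t : ℤ × ℤ × ℤ, Real.sqrt 2 * ∫ q in Q (P t), Ψ q ≤ bump K (fun l => y l - P t l) := by
    intro t
    have hfin : volume (Q (P t)) < ⊤ := by rw [hQv]; exact ENNReal.ofReal_lt_top
    have h1 : ∫ q in Q (P t), bump K (fun l => y l - P t l) =
        (1 / Real.sqrt 2) * bump K (fun l => y l - P t l) := by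
      rw [setIntegral_const, smul_eq_mul, measureReal_def, hvolR]
    have h2 : ∫ q in Q (P t), Ψ q ≤ ∫ q in Q (P t), bump K (fun l => y l - P t l) := by
      refine setIntegral_mono_on hΨint.integrableOn ((integrableOn_const_iff).2 (Or.inr hfin))
        (hQm _) fun q hq => ?_
      have := minorant_le_bump hK0 y (P t) q (hQd _ q hq)
      simpa [hΨ] using this
    rw [h1] at h2
    rw [← le_div_iff₀' hr2, div_eq_inv_mul, ← one_div]
    exact h2
  -- the cells of distinct indices are disjoint
  have hdisj : Set.Pairwise (↑F) (Function.onFun Disjoint fun t => Q (P t)) := by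
    intro a _ b _ hab
    have hne : (a.1, a.2.1, a.2.2) ≠ (b.1, b.2.1, b.2.2) := by simpa using hab
    exact hQdisj s _ _ _ _ _ _ hne
  have hsum : ∑ t ∈ F, ∫ q in Q (P t), Ψ q = ∫ q in ⋃ t ∈ F, Q (P t), Ψ q :=
    (integral_biUnion_finset F (fun t _ => hQm _) hdisj (fun t _ => hΨint.integrableOn)).symm
  -- the union of the cells of `F` carries all of `Ψ` (covering)
  have hcarry : ∫ q in ⋃ t ∈ F, Q (P t), Ψ q = ∫ q, Ψ q := by
    refine setIntegral_eq_integral_of_forall_compl_eq_zero fun q hq => ?_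
    by_contra hne
    apply hq
    obtain ⟨k, i, j, hmem⟩ := hQcov s q
    have hlt : Real.sqrt (dot3 (q - y) (q - y)) < K - 2 := by
      by_contra hge
      rw [not_lt] at hge
      exact hne (minorant_eq_zero_of_le hK0 y hge)
    have hdist := hQd _ q hmem
    -- `|y − P_kij| ≤ |y − q| + |q − P_kij| < K`
    have htri := sqrt_dot3_add_le (y - q) (q - WithLp.ofLp (barlowPos 1 (Real.sqrt (2 / 3)) s k i j))
    have e1 : (y - q) + (q - WithLp.ofLp (barlowPos 1 (Real.sqrt (2 / 3)) s k i j)) =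
        y - WithLp.ofLp (barlowPos 1 (Real.sqrt (2 / 3)) s k i j) := by abel
    have e2 : dot3 (y - q) (y - q) = dot3 (q - y) (q - y) := by
      simp only [dot3, Pi.sub_apply]; ring
    rw [e1, e2] at htri
    have hin : (k, i, j) ∈ F := hF k i j (by linarith)
    exact Set.mem_biUnion hin hmem
  -- translate and compare with the bump
  have htrans : ∫ q, Ψ q = ∫ q : Fin 3 → ℝ, bumpConst / K ^ 3 *
      (max 0 (1 - (max 0 ((Real.sqrt (dot3 q q) + 2) / K)) ^ 2)) ^ 3 := by
    rw [hΨ]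
    exact integral_sub_right_eq_self (fun q : Fin 3 → ℝ => bumpConst / K ^ 3 *
      (max 0 (1 - (max 0 ((Real.sqrt (dot3 q q) + 2) / K)) ^ 2)) ^ 3) y
  have herr := integral_bump_sub_le_integral_minorant hK0
  -- assemble
  calc Real.sqrt 2 * (∫ u, bump K u) - 96 * Real.sqrt 2 * bumpConst / K
      = Real.sqrt 2 * ((∫ u, bump K u) - 96 * bumpConst / K) := by ring
    _ ≤ Real.sqrt 2 * ∫ q, Ψ q := by
        rw [htrans]; exact mul_le_mul_of_nonneg_left herr hr2.le
    _ = Real.sqrt 2 * ∑ t ∈ F, ∫ q in Q (P t), Ψ q := by rw [hsum, hcarry]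
    _ = ∑ t ∈ F, Real.sqrt 2 * ∫ q in Q (P t), Ψ q := by rw [Finset.mul_sum]
    _ ≤ ∑ t ∈ F, bump K (fun l => y l - P t l) := Finset.sum_le_sum fun t _ => hpt t

end Summit.Ventures.Crystal3D.Theorems.PlateauHeight

end
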